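import Summits.KontsevichZagierPeriods.KontsevichZagierPeriods.Theorems.SoloBlindZetaTwoReps
import Summits.KontsevichZagierPeriods.KontsevichZagierPeriods.Theorems.SoloBlindBoxKernel
import Summits.KontsevichZagierPeriods.KontsevichZagierPeriods.Theorems.SoloBlindBoxExamples
import HarnessLib

/-!
# Serret's integral inside the rules, I: the data

Serret's integral `∫₀¹ log(1+x) dx/(1+x²) = (π/8) log 2` (1844; Putnam 2005 A5) is, written
with `log(1+x) = ∫₁^{1+x} ds/s`, the absolutely convergent rational double integral
`S = [T, ds dx/(s(1+x²))]`, `T = {1 ≤ s ≤ 1+x, x ≤ 1}` — a genuinely two-dimensional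
representation of the MIXED period `(π/8)·log 2`, outside every rank-one sector.  This file sets
up the data for the two-move proof in `SoloBlindSerret`:

* the rational cells `L = [[1,2], dx/x]` (`log 2`) and `A = [[0,1], dx/(1+x²)]` (`π/4`), their
  Fubini product `L × A = [[1,2]×[0,1], ds dx/(s(1+x²))]` (domain, integrand, value, membership
  in the box ring);
* Serret's triangle `T`, its mirror `T' = {0 ≤ x, 1+x ≤ s ≤ 2}`, the decomposition of the box
  `[1,2]×[0,1] = T ∪ T'` with null overlap `{s = 1+x}`;
* the representations `S = [T, f]`, `S' = [T', f]`, `f = 1/(s(1+x²))`, with integrability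
  inherited from the product.

References: J.-A. Serret (1844); M. Kontsevich, D. Zagier, *Periods* (2001), §1.2.
-/

noncomputable section

namespace Summit.KontsevichZagierPeriods.KontsevichZagierPeriods.Theorems

open Set MeasureTheory
open Literature.ModelTheory.ExponentialFields (IsSemialgebraic isSemialgebraic_setOf_eval_le)
open MvPolynomial (aeval X)
open Literature.NumberTheory.Transcendental
open Literature.NumberTheory.Transcendental.KZ

namespace SoloBlind

/-! ## The two cells `L = [[1,2], dx/x]` and `A = [[0,1], dx/(1+x²)]` -/

/-- `L = [[1,2], dx/x]`, the rational logarithmic cell of `log 2`. -/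
def logTwoCell : IntegralRep 1 :=
  logCell ((1:ℚ):ℝ) 2 (isAlgebraic_rat ℚ 1) (by simpa using isAlgebraic_nat (R := ℚ) (A := ℝ) 2)

/-- `A = [[0,1], dx/(1+x²)]`, the rational arctangent cell of `π/4`. -/
def atanOneCell : IntegralRep 1 := atanCell ((1:ℚ):ℝ) 1 (isAlgebraic_rat ℚ 1) isAlgebraic_one

/-- `value L = log 2`. -/
theorem logTwoCell_value : logTwoCell.value = Real.log 2 := by
  rw [logTwoCell, value_logCell (by norm_num : (1:ℝ) ≤ 2), Rat.cast_one, one_mul]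

/-- `value A = π/4`. -/
theorem atanOneCell_value : atanOneCell.value = Real.pi / 4 := by
  rw [atanOneCell, value_atanCell zero_le_one, Rat.cast_one, one_mul, Real.arctan_one]

/-- `L` is rational. -/
theorem isRational_logTwoCell : logTwoCell.IsRational :=
  isRational_logCell 1 (by simpa using isAlgebraic_nat (R := ℚ) (A := ℝ) 2)

/-- `A` is rational. -/
theorem isRational_atanOneCell : atanOneCell.IsRational := isRational_atanCell 1 isAlgebraic_one

/-- `L × A` lies in the box ring. -/
theorem of_prod_log_atan_mem_boxRing : of (logTwoCell.prod atanOneCell) ∈ boxRing :=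
  of_prod_mem_boxRing _ _ le_rfl le_rfl isRational_logTwoCell isRational_atanOneCell

/-- `value (L × A) = (π/4) log 2`. -/
theorem prod_log_atan_value :
    (logTwoCell.prod atanOneCell).value = Real.log 2 * (Real.pi / 4) := by
  rw [IntegralRep.value_prod, logTwoCell_value, atanOneCell_value]

/-! ## Serret's triangle `T`, its mirror `T'`, and the box -/

/-- The box `[1,2] × [0,1]`. -/
def kzBox : Set (Fin 2 → ℝ) := {z | (1 ≤ z 0 ∧ z 0 ≤ 2) ∧ (0 ≤ z 1 ∧ z 1 ≤ 1)}

/-- Serret's triangle `T = {1 ≤ s ≤ 1+x, x ≤ 1}` (coordinates `s = z 0`, `x = z 1`). -/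
def kzSerret : Set (Fin 2 → ℝ) := {z | 1 ≤ z 0 ∧ z 0 ≤ 1 + z 1 ∧ z 1 ≤ 1}

/-- The mirror triangle `T' = {0 ≤ x, 1+x ≤ s ≤ 2}`. -/
def kzSerret' : Set (Fin 2 → ℝ) := {z | 0 ≤ z 1 ∧ 1 + z 1 ≤ z 0 ∧ z 0 ≤ 2}

/-- Membership in the box, unfolded. -/
theorem mem_kzBox {z : Fin 2 → ℝ} :
    z ∈ kzBox ↔ (1 ≤ z 0 ∧ z 0 ≤ 2) ∧ (0 ≤ z 1 ∧ z 1 ≤ 1) := Iff.rfl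

/-- Membership in `T`, unfolded. -/
theorem mem_kzSerret {z : Fin 2 → ℝ} : z ∈ kzSerret ↔ 1 ≤ z 0 ∧ z 0 ≤ 1 + z 1 ∧ z 1 ≤ 1 :=
  Iff.rfl

/-- Membership in `T'`, unfolded. -/
theorem mem_kzSerret' {z : Fin 2 → ℝ} : z ∈ kzSerret' ↔ 0 ≤ z 1 ∧ 1 + z 1 ≤ z 0 ∧ z 0 ≤ 2 :=
  Iff.rfl

/-- `T` is `ℚ`-semialgebraic. -/
theorem isSemialgebraic_kzSerret : IsSemialgebraic ℚ kzSerret := by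
  have h1 : IsSemialgebraic ℚ {x : Fin 2 → ℝ |
      aeval x (1 : MvPolynomial (Fin 2) ℚ) ≤ aeval x (X 0 : MvPolynomial (Fin 2) ℚ)} :=
    isSemialgebraic_setOf_eval_le _ _
  have h2 : IsSemialgebraic ℚ {x : Fin 2 → ℝ |
      aeval x (X 0 : MvPolynomial (Fin 2) ℚ) ≤ aeval x (1 + X 1 : MvPolynomial (Fin 2) ℚ)} :=
    isSemialgebraic_setOf_eval_le _ _
  have h3 : IsSemialgebraic ℚ {x : Fin 2 → ℝ |
      aeval x (X 1 : MvPolynomial (Fin 2) ℚ) ≤ aeval x (1 : MvPolynomial (Fin 2) ℚ)} :=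
    isSemialgebraic_setOf_eval_le _ _
  convert (h1.inter h2).inter h3 using 1
  ext z
  simp [kzSerret, and_assoc]

/-- `T'` is `ℚ`-semialgebraic. -/
theorem isSemialgebraic_kzSerret' : IsSemialgebraic ℚ kzSerret' := by
  have h1 : IsSemialgebraic ℚ {x : Fin 2 → ℝ |
      aeval x (0 : MvPolynomial (Fin 2) ℚ) ≤ aeval x (X 1 : MvPolynomial (Fin 2) ℚ)} :=
    isSemialgebraic_setOf_eval_le _ _
  have h2 : IsSemialgebraic ℚ {x : Fin 2 → ℝ |
      aeval x (1 + X 1 : MvPolynomial (Fin 2) ℚ) ≤ aeval x (X 0 : MvPolynomial (Fin 2) ℚ)} :=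
    isSemialgebraic_setOf_eval_le _ _
  have h3 : IsSemialgebraic ℚ {x : Fin 2 → ℝ |
      aeval x (X 0 : MvPolynomial (Fin 2) ℚ) ≤ aeval x (2 : MvPolynomial (Fin 2) ℚ)} :=
    isSemialgebraic_setOf_eval_le _ _
  convert (h1.inter h2).inter h3 using 1
  ext z
  simp [kzSerret', and_assoc]

/-- `T` is measurable. -/
theorem measurableSet_kzSerret : MeasurableSet kzSerret :=
  isSemialgebraic_kzSerret.measurableSet_holds

/-- `T'` is measurable. -/
theorem measurableSet_kzSerret' : MeasurableSet kzSerret' :=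
  isSemialgebraic_kzSerret'.measurableSet_holds

/-- The box is the union of the two triangles. -/
theorem kzBox_eq_union : kzBox = kzSerret ∪ kzSerret' := by
  ext z
  simp only [mem_union, mem_kzBox, mem_kzSerret, mem_kzSerret']
  constructor
  · rintro ⟨⟨h1, h2⟩, h3, h4⟩
    rcases le_or_gt (z 0) (1 + z 1) with h | h
    · exact Or.inl ⟨h1, h, h4⟩
    · exact Or.inr ⟨h3, h.le, h2⟩
  · rintro (⟨h1, h2, h3⟩ | ⟨h1, h2, h3⟩)
    · exact ⟨⟨h1, by linarith⟩, by linarith, h3⟩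
    · exact ⟨⟨by linarith, h3⟩, h1, by linarith⟩

/-- The box is measurable. -/
theorem measurableSet_kzBox : MeasurableSet kzBox := by
  rw [kzBox_eq_union]
  exact measurableSet_kzSerret.union measurableSet_kzSerret'

/-- The overlap `T ∩ T' ⊆ {s = 1+x}` is a null set (a translate of a line through the origin). -/
theorem volume_kzSerret_inter : volume (kzSerret ∩ kzSerret') = 0 := by
  let L : (Fin 2 → ℝ) →ₗ[ℝ] ℝ :=
    LinearMap.proj (R := ℝ) (φ := fun _ : Fin 2 => ℝ) 1 -
      LinearMap.proj (R := ℝ) (φ := fun _ : Fin 2 => ℝ) 0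
  have hS : LinearMap.ker L ≠ ⊤ := by
    intro h
    have h1 : (![1, 0] : Fin 2 → ℝ) ∈ LinearMap.ker L := h ▸ Submodule.mem_top
    rw [LinearMap.mem_ker] at h1
    simp [L] at h1
  have hK : volume ((fun z : Fin 2 → ℝ => -![1, 0] + z) ⁻¹'
      (LinearMap.ker L : Set (Fin 2 → ℝ))) = 0 := by
    rw [measure_preimage_add]
    exact Measure.addHaar_submodule volume (LinearMap.ker L) hS
  refine measure_mono_null (fun z hz => ?_) hK
  obtain ⟨⟨-, h2, -⟩, -, h2', -⟩ := hz
  have h : z 0 = 1 + z 1 := le_antisymm h2 h2'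
  have hw : -![(1:ℝ), 0] + z = ![z 1, z 1] := by
    funext i
    fin_cases i
    · simp [h]
    · simp
  rw [mem_preimage, hw, SetLike.mem_coe, LinearMap.mem_ker]
  simp [L]

/-- The domain of `L × A` is the box. -/
theorem prod_log_atan_domain : (logTwoCell.prod atanOneCell).domain = kzBox := by
  ext z
  simp only [IntegralRep.prod_domain, IntegralRep.mem_prodDomain, logTwoCell, atanOneCell,
    logCell_eq, atanCell_eq, logSeg_domain, atanSeg_domain, mem_line, mem_Icc,
    (show (Fin.castAdd 1 (0 : Fin 1) : Fin 2) = 0 from rfl),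
    (show (Fin.natAdd 1 (0 : Fin 1) : Fin 2) = 1 from rfl)]
  exact Iff.rfl

/-- The integrand of `L × A` is `f(s,x) = 1/(s(1+x²))`. -/
theorem prod_log_atan_integrand (z : Fin 2 → ℝ) :
    (logTwoCell.prod atanOneCell).integrand z = 1 / (z 0 * (1 + z 1 ^ 2)) := by
  rw [IntegralRep.prod_integrand_eq, IntegralRep.prodFun_apply]
  simp only [logTwoCell, atanOneCell, logCell_eq, atanCell_eq, logSeg_integrand,
    atanSeg_integrand, (show (Fin.castAdd 1 (0 : Fin 1) : Fin 2) = 0 from rfl),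
    (show (Fin.natAdd 1 (0 : Fin 1) : Fin 2) = 1 from rfl), Rat.cast_one]
  rw [one_div_mul_one_div]

/-- `f` is integrable on the box (it is the integrand of the product `L × A`). -/
theorem integrableOn_serret_box :
    IntegrableOn (fun z : Fin 2 → ℝ => 1 / (z 0 * (1 + z 1 ^ 2))) kzBox := by
  have h := (logTwoCell.prod atanOneCell).integrableOn
  rw [prod_log_atan_domain] at h
  exact h.congr_fun (fun z _ => prod_log_atan_integrand z) measurableSet_kzBox

/-! ## The representations -/

/-- **Serret's integral** `S = [T, ds dx/(s(1+x²))] = ∫₀¹ log(1+x) dx/(1+x²)`. -/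
def serretRep : IntegralRep 2 :=
  ratRep kzSerret (fun z => 1 / (z 0 * (1 + z 1 ^ 2))) 1 (X 0 * (1 + X 1 ^ 2))
    isSemialgebraic_kzSerret
    (fun x hx => by
      rw [mem_kzSerret] at hx
      have h0 : 0 < x 0 := by linarith [hx.1]
      have : 0 < x 0 * (1 + x 1 ^ 2) := by positivity
      simpa using this.ne')
    (fun x _ => by simp)
    (integrableOn_serret_box.mono_set (kzBox_eq_union ▸ subset_union_left))

/-- The mirror `S' = [T', ds dx/(s(1+x²))] = ∫₀¹ (log 2 - log(1+x)) dx/(1+x²)`. -/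
def serretRep' : IntegralRep 2 :=
  ratRep kzSerret' (fun z => 1 / (z 0 * (1 + z 1 ^ 2))) 1 (X 0 * (1 + X 1 ^ 2))
    isSemialgebraic_kzSerret'
    (fun x hx => by
      rw [mem_kzSerret'] at hx
      have h0 : 0 < x 0 := by linarith [hx.1, hx.2.1]
      have : 0 < x 0 * (1 + x 1 ^ 2) := by positivity
      simpa using this.ne')
    (fun x _ => by simp)
    (integrableOn_serret_box.mono_set (kzBox_eq_union ▸ subset_union_right))

/-- `S` is rational. -/
theorem isRational_serretRep : serretRep.IsRational := isRational_ratRep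

/-- `S'` is rational. -/
theorem isRational_serretRep' : serretRep'.IsRational := isRational_ratRep

end SoloBlind

end Summit.KontsevichZagierPeriods.KontsevichZagierPeriods.Theorems
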